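/-
Copyright (c) 2026 the pub-hodgecm-mathlib formalisation cell (harness21).  Prover seat hodgecm-mathlib-A-p03 (g24); LEAD F0P3a-plan (g9) WORD T8-41 «(F4)–(F8) PEN 1»,
architect A-p06 (g26); LAYER B_H (B-p14 (g30) census 8d487f29 §3), 2026-09-01.
-/
import Literature.NumberTheory.Automorphic.UnitaryThreeBorelCosetCountGeneralRatio
import HarnessLib

/-!
# Flicker's Prop. 10, FOURTH REGIME, for a GENERAL off-diagonal ratio `p = B₁∕B₂` (`0 < ord p`, `σp = p`) — LAYER B_H form

Topic `NumberTheory/Automorphic` (road «D-N7-inert», MAP v3 (F4)∕(F11) LAYER B_H); namespace `Literature.NumberTheory.Automorphic.UnitaryGroup`.  THEOREMS ONLY: no definition,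
no named fact, no instance, no notation, no `sorry`; kernel lane.

★ `UnitaryThreeBorelConjugateCongruences` §4, ★ `…BorelCosetCount`, ★ `…BorelCosetCountQuadratic` treat `τ = !![A,0,B₂ϖ^{2j}; 0,b,0; B₂,0,A]` (Flicker's type-(1) torus, `j ≥ 1`).
Flicker's SECOND clause of Prop. 10 (p. 85: «for a regular `t = diag(ε⁻¹(α, βπ∕√D; β√D, α), ι)` in `T_H ⊂ H` … `1`, `(1−q⁻²)q^{4m}` if `1 ≤ m ≤ min([ν∕2],[(1+N₂)∕2])`,
`(1+q⁻¹)q^{ν+2m}` if `ν = 1+N₂ < 2m ≤ 2+2N₂`») concerns corners `!![A,0,B₁; 0,b,0; B₂,0,A]` whose ratio `p := B₁∕B₂` is `(π∕D)·ϖ^{2j}`-like: σ-fixed of POSITIVE, possibly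
ODD, order.  The proofs of the type-(1) files use `p` only through `|p| < 1` (and, in the fourth regime, `σp = p`), so this file re-states them for a general `p`
(`hB₁ : B₁ = B₂ * p`, `hvp : |p| < 1`, `hσp : σ p = p`).  THIS FILE: the fourth regime — `borel_conj_mem_flickerHK_iff_quadratic_gen`, `v_quadratic_le_iff_factor_eq_zero_gen`,
`natCard_cosets_regime_four_gen` (= `F · q^m · q^{m−k} · q^{m−1}(q+1)` over ★ `natCard_pairs_norm_quadratic_eq`, which is already stated for a general `p ∈ 𝓂`).
HONEST LABEL: HC_CM is proved only modulo the printed citations until rung 0 closes; no new mathematics — a parameter generalisation of ★ p841010∕p841073∕p841308.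

## References
* [Flicker1998UnitaryFL] Y. Z. Flicker, *Elementary proof of the fundamental lemma for a unitary group*, Canad. J. Math. 50 (1998), 74–98: Prop. 10 pp. 85–86 (both clauses).
* [Rogawski1990] J. D. Rogawski, *Automorphic Representations of Unitary Groups in Three Variables* (1990), §4.9 p. 55.
-/

set_option autoImplicit false

open scoped MatrixGroups WithZero Valued
open Matrix

namespace Literature.NumberTheory.Automorphic

namespace UnitaryGroup

open Literature.NumberTheory.Automorphic.HermitianLattice (unitaryInt mem_unitaryInt_iff LocalConjDatum)
open Literature.NumberTheory.LocalFields.UnramifiedQuadraticNorm IsLocalRing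

variable {K : Type*} [Field K] [Valued K ℤᵐ⁰] {ϖ : K} (σ : K →+* K) {J : Matrix (Fin 3) (Fin 3) K}

/-- **Regime 4 in coordinates**: for `p = p(u,x,w) ∈ P_H`, `τ = !![A,0,B₂ϖ^{2j}; 0,b,0; B₂,0,A] ∈ H` with `|B₂| = |ϖ^ν| = |A − b|` (`N₊ = ν`), `m ≤ ν`, `ν + k = 2m`:
`p⁻¹ τ p ∈ H^K_m ↔ |n²(1−x²) + d·n + ϖ^{2j}| ≤ |ϖ^k|`, `n = uσu`, `d = 2(A−b)∕B₂` (★ `condition_four_iff_quadratic`; conditions (1)–(3) hold automatically).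
[cite: Flicker1998UnitaryFL, Prop. 10 p. 86] -/
theorem borel_conj_mem_flickerHK_iff_quadratic_gen (hJ : J = (StdForm.antidiagonal 3).over K) (hd : LocalConjDatum σ ϖ) {y : K}
    (hy : y * σ y = -2) {m ν k : ℕ} (hmν : m ≤ ν) (hνk : ν + k = 2 * m)
    {c um p τ : ↥(unitaryGroupOfForm σ J)} (hc : ((c : GL (Fin 3) K) : Matrix (Fin 3) (Fin 3) K) = !![1, 0, 0; 0, -1, 0; 0, 0, 1])
    (hum : ((um : GL (Fin 3) K) : Matrix (Fin 3) (Fin 3) K) = !![ϖ ^ m, y, (ϖ ^ m)⁻¹; 0, 1, -σ y * (ϖ ^ m)⁻¹; 0, 0, (ϖ ^ m)⁻¹])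
    {u x w A B₁ B₂ b p₁ : K} (hp : p ∈ flickerPH σ J c)
    (hpm : ((p : GL (Fin 3) K) : Matrix (Fin 3) (Fin 3) K) = !![u, 0, u * x; 0, w, 0; 0, 0, (σ u)⁻¹])
    (hB₁ : B₁ = B₂ * p₁) (hτ : ((τ : GL (Fin 3) K) : Matrix (Fin 3) (Fin 3) K) = !![A, 0, B₁; 0, b, 0; B₂, 0, A])
    (hτH : τ ∈ Subgroup.centralizer ({c} : Set ↥(unitaryGroupOfForm σ J)))
    (hB₂ : Valued.v B₂ = Valued.v (ϖ ^ ν)) (hs : Valued.v (A - b) = Valued.v (ϖ ^ ν)) :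
    p⁻¹ * τ * p ∈ flickerHK σ J c um ↔
      Valued.v ((u * σ u) ^ 2 * (1 - x ^ 2) + (2 * (A - b) / B₂) * (u * σ u) + p₁) ≤ Valued.v (ϖ ^ k) := by
  have h2 : (2 : K) ≠ 0 := fun h => by have := hd.v2; rw [h, map_zero] at this; exact zero_ne_one this
  have hϖ0 : ϖ ≠ 0 := hd.ϖ_ne_zero
  obtain ⟨u', x', w', hpm', hvu, hvx, hσx, hvw, hσw⟩ := exists_coe_eq_borel_of_mem_flickerPH σ hJ hd hc hp
  have hu' : u' = u := by have := congrFun (congrFun (hpm'.symm.trans hpm) 0) 0; simpa using this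
  have hw' : w' = w := by have := congrFun (congrFun (hpm'.symm.trans hpm) 1) 1; simpa using this
  subst hu' hw'
  have hu0 : u' ≠ 0 := fun h => by rw [h, map_zero] at hvu; exact zero_ne_one hvu
  have hx' : x' = x := by
    have := congrFun (congrFun (hpm'.symm.trans hpm) 0) 2
    simpa [hu0] using this
  subst hx'
  have hσu0 : σ u' ≠ 0 := fun h => hu0 (by rw [← hd.σσ u', h, map_zero])
  have hw0 : w' ≠ 0 := fun h => by rw [h, map_zero] at hvw; exact zero_ne_one hvw
  have hpH : p ∈ Subgroup.centralizer ({c} : Set ↥(unitaryGroupOfForm σ J)) := ((mem_flickerPH_iff h2 hc).1 hp).1.1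
  rw [borel_conj_mem_flickerHK_iff σ hJ hd hy m hu0 hσu0 hw0 hum hpm hτ hpH hτH]
  have hn : Valued.v (u' * σ u') = 1 := by rw [map_mul, hd.vσ, hvu, mul_one]
  have hB₂0 : B₂ ≠ 0 := fun h => by
    rw [h, map_zero] at hB₂; exact (pow_ne_zero _ hϖ0) ((map_eq_zero _).1 hB₂.symm)
  have hmν' : Valued.v (ϖ ^ ν) ≤ Valued.v (ϖ ^ m) := by
    rw [hd.v_pow, hd.v_pow, WithZero.exp_le_exp]; omega
  have hB₂m : Valued.v B₂ ≤ Valued.v (ϖ ^ m) := hB₂ ▸ hmν'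
  have c1 : Valued.v ((u' * σ u') * B₂) ≤ 1 := by rw [map_mul, hn, one_mul]; exact le_trans hB₂m (hd.v_pow_le_one m)
  have c23 := (two_congruences_iff_of_v_B₂_le (ϖ := ϖ) hB₂m hn hvx).2 (hs ▸ hmν')
  rw [condition_four_iff_quadratic_gen (ϖ := ϖ) hB₂0 hn hB₁]
  have e : Valued.v (ϖ ^ m) * Valued.v (ϖ ^ m) = Valued.v (ϖ ^ ν) * Valued.v (ϖ ^ k) := by
    rw [← map_mul, ← map_mul, ← pow_add, ← pow_add]; congr 2; omega
  constructor
  · rintro ⟨-, -, -, h4⟩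
    rw [hB₂, e] at h4
    have hpos : 0 < Valued.v (ϖ ^ ν) := by rw [hd.v_pow]; exact WithZero.zero_lt_coe _
    exact le_of_mul_le_mul_left h4 hpos
  · intro h4
    refine ⟨c1, c23.1, c23.2, ?_⟩
    rw [hB₂, e]
    exact mul_le_mul_right h4 _


/-- **The quadratic inequality as a predicate on classes**: for integers `a, x, d` and `p₀ = ϖ^{2j}`, `|N(a)²(1−x²) + d N(a) + ϖ^{2j}| ≤ |ϖ^k|` iff
`φ((ā σ̄ā)²(1 − x̄²) + d̄ (ā σ̄ā) + p̄₀) = 0` in `𝒪⧸𝓂^k` (classes mod `𝓂^m`, `k ≤ m`). [cite: Flicker1998UnitaryFL, Prop. 10 p. 86] -/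
theorem v_quadratic_le_iff_factor_eq_zero_gen (hd : LocalConjDatum σ ϖ) (hσO : ∀ y : 𝒪[K], (σ.comp 𝒪[K].subtype) y ∈ 𝒪[K])
    {k m : ℕ} (hkm : k ≤ m) {a x d p : K} (ha : Valued.v a ≤ 1) (hx : Valued.v x ≤ 1) (hdv : Valued.v d ≤ 1) (hvp1 : Valued.v p ≤ 1) :
    Valued.v ((a * σ a) ^ 2 * (1 - x ^ 2) + d * (a * σ a) + p) ≤ Valued.v (ϖ ^ k) ↔
      Ideal.Quotient.factor (Ideal.pow_le_pow_right hkm)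
        ((Ideal.Quotient.mk (𝓂[K] ^ m) ⟨a, ha⟩ *
            Ideal.quotientMap (𝓂[K] ^ m) ((σ.comp 𝒪[K].subtype).codRestrict 𝒪[K] hσO)
              (maximalIdeal_pow_le_comap_codRestrict σ hd.vϖ hd.vσ hσO m) (Ideal.Quotient.mk (𝓂[K] ^ m) ⟨a, ha⟩)) ^ 2 *
            (1 - (Ideal.Quotient.mk (𝓂[K] ^ m) ⟨x, hx⟩) ^ 2) +
          Ideal.Quotient.mk (𝓂[K] ^ m) ⟨d, hdv⟩ *
            (Ideal.Quotient.mk (𝓂[K] ^ m) ⟨a, ha⟩ *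
              Ideal.quotientMap (𝓂[K] ^ m) ((σ.comp 𝒪[K].subtype).codRestrict 𝒪[K] hσO)
                (maximalIdeal_pow_le_comap_codRestrict σ hd.vϖ hd.vσ hσO m) (Ideal.Quotient.mk (𝓂[K] ^ m) ⟨a, ha⟩)) +
          Ideal.Quotient.mk (𝓂[K] ^ m) ⟨p, hvp1⟩) = 0 := by
  have hσa : Valued.v (σ a) ≤ 1 := by rw [hd.vσ]; exact ha
  set E₀ : 𝒪[K] := (⟨a, ha⟩ * ⟨σ a, hσa⟩) ^ 2 * (1 - ⟨x, hx⟩ ^ 2) + ⟨d, hdv⟩ * (⟨a, ha⟩ * ⟨σ a, hσa⟩) +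
    ⟨p, hvp1⟩ with hE₀
  have hcoe : (E₀ : K) = (a * σ a) ^ 2 * (1 - x ^ 2) + d * (a * σ a) + p := by
    simp [hE₀]
  have hσmk : Ideal.quotientMap (𝓂[K] ^ m) ((σ.comp 𝒪[K].subtype).codRestrict 𝒪[K] hσO)
      (maximalIdeal_pow_le_comap_codRestrict σ hd.vϖ hd.vσ hσO m) (Ideal.Quotient.mk (𝓂[K] ^ m) ⟨a, ha⟩) =
      Ideal.Quotient.mk (𝓂[K] ^ m) ⟨σ a, hσa⟩ := by
    rw [Ideal.quotientMap_mk]; rfl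
  rw [hσmk, ← hcoe, ← factor_mk_eq_zero_iff hd.vϖ hkm E₀]
  simp only [hE₀, map_add, map_mul, map_pow, map_sub, map_one]


section RegimeFourGen

variable [IsDiscreteValuationRing 𝒪[K]] [Finite (ResidueField 𝒪[K])] [IsAdicComplete (maximalIdeal 𝒪[K]) 𝒪[K]]

/-- **PROP. 10, FOURTH REGIME, AS A COSET COUNT** (`|B₂| = |A − b| = |ϖ^ν|`, `1 ≤ m ≤ ν`, `ν + k = 2m`, `k ≥ 1`, `j ≥ 1`, `|σd − d| ≤ |ϖ^k|` for `d = 2(A−b)∕B₂`):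
`#{y ∈ P_H ⧸ (P_H ∩ H^K_m) : y⁻¹ τ y ∈ H^K_m} = F · q^m · q^{m−k} · q^{m−1}(q+1)`, where `F` is the common size of the fibres of `ρ_m` on the coset space ((H2):
`F = [N₀ : P_H ∩ H^K_m] = q^m`, B-p04 FILE C) — Flicker's `(1 + q⁻¹)q^{ν+2m}`.  Ingredients: §2–§3 (the condition is the quadratic predicate of `ρ_m`), ★ (H1)(H3)
(image = unit × anti-fixed, fibres = `N₀`-cosets), ★ `natCard_pairs_norm_quadratic_eq` at `R = 𝒪[K]`. [cite: Flicker1998UnitaryFL, Prop. 10 p. 86] -/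
theorem natCard_cosets_regime_four_gen (hJ : J = (StdForm.antidiagonal 3).over K) (hd : LocalConjDatum σ ϖ)
    (hσO : ∀ y : 𝒪[K], (σ.comp 𝒪[K].subtype) y ∈ 𝒪[K]) {y : K} (hy : y * σ y = -2)
    {m ν k : ℕ} (hm : 1 ≤ m) (hmν : m ≤ ν) (hνk : ν + k = 2 * m) (hk : 1 ≤ k)
    {c um τ : ↥(unitaryGroupOfForm σ J)} (hc : ((c : GL (Fin 3) K) : Matrix (Fin 3) (Fin 3) K) = !![1, 0, 0; 0, -1, 0; 0, 0, 1])
    (hum : ((um : GL (Fin 3) K) : Matrix (Fin 3) (Fin 3) K) = !![ϖ ^ m, y, (ϖ ^ m)⁻¹; 0, 1, -σ y * (ϖ ^ m)⁻¹; 0, 0, (ϖ ^ m)⁻¹])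
    {A B₁ B₂ b p₁ : K} (hB₁ : B₁ = B₂ * p₁) (hvp : Valued.v p₁ < 1) (hσp₁ : σ p₁ = p₁)
    (hτ : ((τ : GL (Fin 3) K) : Matrix (Fin 3) (Fin 3) K) = !![A, 0, B₁; 0, b, 0; B₂, 0, A])
    (hτH : τ ∈ Subgroup.centralizer ({c} : Set ↥(unitaryGroupOfForm σ J)))
    (hB₂ : Valued.v B₂ = Valued.v (ϖ ^ ν)) (hs : Valued.v (A - b) = Valued.v (ϖ ^ ν))
    (hσd : Valued.v (σ (2 * (A - b) / B₂) - 2 * (A - b) / B₂) ≤ Valued.v (ϖ ^ k))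
    {q : ℕ} (hq : Nat.card (ResidueField 𝒪[K]) = q ^ 2)
    {a₀ : 𝒪[K]} (ha₀ : IsUnit (((σ.comp 𝒪[K].subtype).codRestrict 𝒪[K] hσO) a₀ - a₀))
    (hSN : flickerPH σ J c ⊓ flickerHK σ J c um ≤ flickerPH0 σ J c (ϖ ^ m))
    [Finite (↥(flickerPH σ J c) ⧸ (flickerHK σ J c um).subgroupOf (flickerPH σ J c))] {F : ℕ}
    (hfib : ∀ z ∈ Set.range (fun w : ↥(flickerPH σ J c) ⧸ (flickerHK σ J c um).subgroupOf (flickerPH σ J c) =>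
        flickerPHRho σ m ((Quotient.out w : ↥(flickerPH σ J c)) : ↥(unitaryGroupOfForm σ J))),
      Nat.card {w : ↥(flickerPH σ J c) ⧸ (flickerHK σ J c um).subgroupOf (flickerPH σ J c) //
        flickerPHRho σ m ((Quotient.out w : ↥(flickerPH σ J c)) : ↥(unitaryGroupOfForm σ J)) = z} = F) :
    Nat.card {w : ↥(flickerPH σ J c) ⧸ (flickerHK σ J c um).subgroupOf (flickerPH σ J c) //
      ((Quotient.out w : ↥(flickerPH σ J c)) : ↥(unitaryGroupOfForm σ J))⁻¹ * τ * (Quotient.out w : ↥(flickerPH σ J c)) ∈ flickerHK σ J c um} =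
      F * (q ^ m * (q ^ (m - k) * (q ^ (m - 1) * (q + 1)))) := by
  classical
  have h2v : Valued.v (2 : K) = 1 := hd.v2
  have h2 : (2 : K) ≠ 0 := fun h => by rw [h, map_zero] at h2v; exact zero_ne_one h2v
  have hϖ0 : ϖ ≠ 0 := hd.ϖ_ne_zero
  have hkm : k ≤ m := by omega
  -- the restricted involution and the data in `𝒪[K]`
  set σO : 𝒪[K] →+* 𝒪[K] := (σ.comp 𝒪[K].subtype).codRestrict 𝒪[K] hσO with hσOdef
  have hσOσO : ∀ z, σO (σO z) = z := fun z => Subtype.ext (hd.σσ (z : K))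
  have hB₂0 : B₂ ≠ 0 := fun h => by
    rw [h, map_zero] at hB₂; exact (pow_ne_zero _ hϖ0) ((map_eq_zero _).1 hB₂.symm)
  set d : K := 2 * (A - b) / B₂ with hddef
  have hdv : Valued.v d = 1 := by
    rw [hddef, map_div₀, map_mul, h2v, one_mul, hs, hB₂, div_self]
    rw [hd.v_pow]; exact WithZero.coe_ne_zero
  set d₀ : 𝒪[K] := ⟨d, hdv.le⟩ with hd₀
  have hd₀u : IsUnit d₀ := (Valuation.Integers.isUnit_iff_valuation_eq_one (Valuation.integer.integers _)).2 hdv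
  have hσd₀ : σO d₀ - d₀ ∈ 𝓂[K] ^ k := by
    rw [mem_maximalIdeal_pow_iff_v_le hd.vϖ]; exact hσd
  set p₀ : 𝒪[K] := ⟨p₁, hvp.le⟩ with hp₀
  have hp₀m : p₀ ∈ 𝓂[K] := by
    rw [mem_maximalIdeal, mem_nonunits_iff, Valuation.Integers.isUnit_iff_valuation_eq_one (Valuation.integer.integers _)]
    change Valued.v p₁ ≠ 1
    exact hvp.ne
  have hσp₀ : σO p₀ = p₀ := Subtype.ext (by change σ p₁ = p₁; exact hσp₁)
  have h2O : IsUnit (2 : 𝒪[K]) :=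
    (Valuation.Integers.isUnit_iff_valuation_eq_one (Valuation.integer.integers _)).2 (by rw [map_ofNat]; exact h2v)
  -- the predicate counted by the pair count, and the map `f = ρ_m ∘ out`
  set P := flickerPH σ J c with hPdef
  set S := (flickerHK σ J c um).subgroupOf (flickerPH σ J c) with hSdef
  set f : ↥P ⧸ S → (𝒪[K] ⧸ 𝓂[K] ^ m) × (𝒪[K] ⧸ 𝓂[K] ^ m) :=
    fun w => flickerPHRho σ m ((Quotient.out w : ↥P) : ↥(unitaryGroupOfForm σ J)) with hfdef
  set Q : (𝒪[K] ⧸ 𝓂[K] ^ m) × (𝒪[K] ⧸ 𝓂[K] ^ m) → Prop := fun ux =>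
    Ideal.quotientMap (maximalIdeal 𝒪[K] ^ m) σO (maximalIdeal_pow_le_comap σO hσOσO m) ux.2 = -ux.2 ∧ (IsUnit ux.1 ∧
      Ideal.Quotient.factor (Ideal.pow_le_pow_right hkm)
        ((ux.1 * Ideal.quotientMap (maximalIdeal 𝒪[K] ^ m) σO (maximalIdeal_pow_le_comap σO hσOσO m) ux.1) ^ 2 * (1 - ux.2 ^ 2) +
          Ideal.Quotient.mk _ d₀ * (ux.1 * Ideal.quotientMap (maximalIdeal 𝒪[K] ^ m) σO (maximalIdeal_pow_le_comap σO hσOσO m) ux.1) +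
          Ideal.Quotient.mk _ p₀) = 0) with hQdef
  have hσbar : Ideal.quotientMap (maximalIdeal 𝒪[K] ^ m) σO (maximalIdeal_pow_le_comap σO hσOσO m) =
      Ideal.quotientMap (𝓂[K] ^ m) ((σ.comp 𝒪[K].subtype).codRestrict 𝒪[K] hσO) (maximalIdeal_pow_le_comap_codRestrict σ hd.vϖ hd.vσ hσO m) := rfl
  -- Step A: «good» ⟺ `Q ∘ f`
  have stepA : ∀ w : ↥P ⧸ S, ((Quotient.out w : ↥P) : ↥(unitaryGroupOfForm σ J))⁻¹ * τ * (Quotient.out w : ↥P) ∈ flickerHK σ J c um ↔ Q (f w) := by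
    intro w
    set pp : ↥(unitaryGroupOfForm σ J) := ((Quotient.out w : ↥P) : ↥(unitaryGroupOfForm σ J)) with hpp
    have hp : pp ∈ flickerPH σ J c := (Quotient.out w).2
    obtain ⟨u, x, wc, hpm, hvu, hvx, hσx, hvw, hσw⟩ := exists_coe_eq_borel_of_mem_flickerPH σ hJ hd hc hp
    have hu0 : u ≠ 0 := fun h => by rw [h, map_zero] at hvu; exact zero_ne_one hvu
    have hw0 : wc ≠ 0 := fun h => by rw [h, map_zero] at hvw; exact zero_ne_one hvw
    have hσw0 : σ wc ≠ 0 := fun h => hw0 (by rw [← hd.σσ wc, h, map_zero])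
    have hva : Valued.v (u * wc⁻¹) ≤ 1 := by rw [map_mul, map_inv₀, hvu, hvw, inv_one, one_mul]
    have hρ : f w = (Ideal.Quotient.mk (𝓂[K] ^ m) ⟨u * wc⁻¹, hva⟩, Ideal.Quotient.mk (𝓂[K] ^ m) ⟨x, hvx⟩) := by
      show flickerPHRho σ m pp = _
      rw [flickerPHRho_of_coe_eq σ m hpm hu0, toQuotPow_of_le m hva, toQuotPow_of_le m hvx]
    have hQ1 : Ideal.quotientMap (maximalIdeal 𝒪[K] ^ m) σO (maximalIdeal_pow_le_comap σO hσOσO m) (f w).2 = -(f w).2 := by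
      rw [hσbar]; exact quotientMap_flickerPHRho_snd σ hJ hd hσO hc m hp
    have hQ2 : IsUnit (f w).1 := isUnit_flickerPHRho_fst σ hJ hd hc m hp
    rw [borel_conj_mem_flickerHK_iff_quadratic_gen σ hJ hd hy hmν hνk hc hum hp hpm hB₁ hτ hτH hB₂ hs]
    -- rewrite `uσu = N(u w⁻¹)`
    have hσwc : σ wc = wc⁻¹ := eq_inv_of_mul_eq_one_left hσw
    have hN : u * σ u = (u * wc⁻¹) * σ (u * wc⁻¹) := by
      rw [map_mul, map_inv₀, hσwc, inv_inv]; field_simp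
    rw [hN, v_quadratic_le_iff_factor_eq_zero_gen σ hd hσO hkm hva hvx hdv.le hvp.le]
    rw [hρ] at hQ1 hQ2
    rw [hQdef, hρ]
    exact ⟨fun h => ⟨hQ1, hQ2, h⟩, fun h => h.2.2⟩
  -- Step B: count through `f`
  rw [Nat.card_congr (Equiv.subtypeEquivRight stepA), natCard_subtype_comp_eq_mul f Q F hfib]
  congr 1
  -- Step C: the range condition is implied by `Q` (★ (H3) surjectivity + (H1) + `S ≤ N₀`)
  have stepC : ∀ z, Q z → z ∈ Set.range f := by
    rintro ⟨α, β⟩ ⟨hβ, hα, -⟩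
    obtain ⟨a, rfl⟩ := Ideal.Quotient.mk_surjective α
    obtain ⟨bb, rfl⟩ := Ideal.Quotient.mk_surjective β
    have hau : IsUnit a := isUnit_of_isUnit_mk_pow (R := 𝒪[K]) hm hα
    have hav : Valued.v (a : K) = 1 := (Valuation.Integers.isUnit_iff_valuation_eq_one (Valuation.integer.integers _)).1 hau
    rw [hσbar] at hβ
    obtain ⟨pp, hpp, hρ⟩ := exists_mem_flickerPH_flickerPHRho_eq σ hJ hd hσO hc m a bb hav hβ
    refine ⟨QuotientGroup.mk ⟨pp, hpp⟩, ?_⟩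
    obtain ⟨s, hs'⟩ := QuotientGroup.mk_out_eq_mul S (⟨pp, hpp⟩ : ↥P)
    show flickerPHRho σ m ((Quotient.out (QuotientGroup.mk (⟨pp, hpp⟩ : ↥P) : ↥P ⧸ S) : ↥P) : ↥(unitaryGroupOfForm σ J)) = _
    rw [hs', Subgroup.coe_mul, ← hρ]
    symm
    rw [flickerPHRho_eq_iff σ hJ hd hc m hpp (Subgroup.mul_mem _ hpp (s : ↥P).2), ← mul_assoc, inv_mul_cancel, one_mul]
    exact hSN ⟨(s : ↥P).2, s.2⟩
  rw [Nat.card_congr (Equiv.subtypeEquivRight fun z => (and_iff_right_of_imp (stepC z) : z ∈ Set.range f ∧ Q z ↔ Q z))]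
  -- Step D: the pair count at `R = 𝒪[K]`
  exact natCard_pairs_norm_quadratic_eq σO hσOσO ha₀ hq hk hkm h2O hd₀u hσd₀ hp₀m hσp₀

end RegimeFourGen

end UnitaryGroup

end Literature.NumberTheory.Automorphic
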